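import Literature.Computability.AlgebraicComplexity.LMR13PLambdaStabilizerBlockIIIa
import Literature.Computability.AlgebraicComplexity.SkewPairingInvolutions
import HarnessLib

/-!
# LMR13 §3.5, stabiliser of `P_Λ`: block (III-b) — exchange relations and the vanishing of `(L_X A)_skew`

[topic Computability/AlgebraicComplexity]

Landsberg–Manivel–Ressayre 2013, §3.5 (journal p. 481; arXiv:1004.4802 `p0008.txt:L82–94`): the
`End(Λ²) = 𝔤𝔩_n ⊕ EA`-component of the Lie stabiliser of `P_Λ(A+S) = (1/n)·tr(adj(A)·S)` contributes
`𝔤𝔩_n` ("the contribution of the remaining terms is isomorphic with `𝔤𝔩_n ⊕ 𝔤𝔩_n`"). In the cell's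
elementary route (memo `HOME/lmr/X3b-ELEMENTARY-ROUTE-t10g4.md` §5) this is block (III): the `Λ² → Λ²` part
`α(A) = ½(L_X A − (L_X A)ᵀ)` of `X ∈ 𝔤𝔩(W)_{P_Λ}` vanishes once the `n²` functionals `Φ_{ra}`, `Ψ_j`, `Ψ_{12}`
do. Step (III-a) (`skewPart_linAct_wedge_apply_eq_zero`, `LMR13PLambdaStabilizerBlockIIIa.lean`) shows that
under `Φ = 0` each `α(W_{ab})` (`W_{ab} = E_{ab} − E_{ba}`) is supported on `{(a,b),(b,a)}`, i.e.
`α(W_{ab}) = a′_{ab}·W_{ab}` (`skewPart_linAct_wedge_eq_smul` below). This file is step (III-b):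

* `skewPart_linAct_exchange_of_kappa` — from the **κ-identity in π-independent form**
  `hκ : Σ_x a′_{r↑x, r↑(πx)} = Σ_x a′_{r↑x, r↑(ρx)}` for all fixed-point-free involutions `π, ρ` of the indices
  `≠ r` (the sibling file's (b1): (III) at `S = E_rr`, `A = R_r(J(π,s))`), the EXCHANGE RELATIONS
  `a′_{ij} + a′_{kl} = a′_{ik} + a′_{jl}` for pairwise distinct `i,j,k,l` (`n = h+h+1 ≥ 5`; the involutions
  through `{i,j},{k,l}` and `{i,k},{j,l}` of `SkewPairingInvolutions.lean` differ on four letters only);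
* **`skewPart_linAct_skew_eq_zero_of_kappa`** — with `Ψ_j : a′_{0j} = 0`, `Ψ_{12} : a′_{12} = 0` the exchange
  relations force all `a′ = 0`, hence `½(L_X A − (L_X A)ᵀ) = 0` for every skew `A` (the `blockIII`
  hypothesis shape of `finrank_glAnn_pLambda_le_of_blocks`, `LMR13PLambdaStabilizerAssembly.lean`, modulo `hκ`).

Everything is PROVED; theorems only; no named fact. Honest framing: one half of one block of (X3b);
`LMR2013_prop_3_5_1` remains OPEN in the tree for `n > 3`; VP ≠ VNP is NOT proved and nothing here is progress
on it.

## References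

* [LandsbergManivelRessayre2013] J. M. Landsberg, L. Manivel, N. Ressayre, *Hypersurfaces with degenerate duals and
  the geometric complexity theory program*, Comment. Math. Helv. 88 (2013) 469–484, §3.5 (p. 481).
-/

noncomputable section

open Matrix

namespace Literature.Computability.AlgebraicComplexity

namespace SkewAdj

variable {h : ℕ}

/-! ### The diagonal form `α(W_{ab}) = a′_{ab} · W_{ab}` -/

/-- The skew part `½(N − Nᵀ)` is skew. [cite: LandsbergManivelRessayre2013, §3.5 (p. 481)] -/
theorem transpose_half_sub_transpose {m : ℕ} (N : Matrix (Fin m) (Fin m) ℂ) :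
    ((1 / 2 : ℂ) • (N - Nᵀ))ᵀ = -((1 / 2 : ℂ) • (N - Nᵀ)) := by
  rw [Matrix.transpose_smul, Matrix.transpose_sub, Matrix.transpose_transpose, ← smul_neg, neg_sub]

/-- **Diagonal form of block (III) under `Φ = 0`**: for `X ∈ 𝔤𝔩(W)_{P_Λ}` and `a ≠ b`,
`α(W_{ab}) = a′_{ab} · W_{ab}` with `a′_{ab} = α(W_{ab})_{ab}` (rows off `{a,b}` vanish by
`skewPart_linAct_wedge_apply_eq_zero`, the matrix is skew). [cite: LandsbergManivelRessayre2013, §3.5 (p. 481)] -/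
theorem skewPart_linAct_wedge_eq_smul
    {X : Matrix (Fin (h + h + 1) × Fin (h + h + 1)) (Fin (h + h + 1) × Fin (h + h + 1)) ℂ}
    (hX : X ∈ glAnn (pLambda (h + h + 1)))
    (hΦ : ∀ r a : Fin (h + h + 1), r ≠ a →
      (Matrix.of fun k l => ∑ p : Fin (h + h + 1) × Fin (h + h + 1), X p (k, l) *
        (Matrix.single r a (1 : ℂ) + Matrix.single a r (1 : ℂ)) p.1 p.2) r r = 0)
    {a b : Fin (h + h + 1)} (hab : a ≠ b) :
    (1 / 2 : ℂ) • ((Matrix.of fun k l => ∑ p : Fin (h + h + 1) × Fin (h + h + 1), X p (k, l) *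
        (Matrix.single a b (1 : ℂ) - Matrix.single b a (1 : ℂ)) p.1 p.2) -
      (Matrix.of fun k l => ∑ p : Fin (h + h + 1) × Fin (h + h + 1), X p (k, l) *
        (Matrix.single a b (1 : ℂ) - Matrix.single b a (1 : ℂ)) p.1 p.2)ᵀ) =
    ((1 / 2 : ℂ) • ((Matrix.of fun k l => ∑ p : Fin (h + h + 1) × Fin (h + h + 1), X p (k, l) *
        (Matrix.single a b (1 : ℂ) - Matrix.single b a (1 : ℂ)) p.1 p.2) -
      (Matrix.of fun k l => ∑ p : Fin (h + h + 1) × Fin (h + h + 1), X p (k, l) *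
        (Matrix.single a b (1 : ℂ) - Matrix.single b a (1 : ℂ)) p.1 p.2)ᵀ)) a b •
      (Matrix.single a b (1 : ℂ) - Matrix.single b a (1 : ℂ)) := by
  set M := (1 / 2 : ℂ) • ((Matrix.of fun k l => ∑ p : Fin (h + h + 1) × Fin (h + h + 1), X p (k, l) *
        (Matrix.single a b (1 : ℂ) - Matrix.single b a (1 : ℂ)) p.1 p.2) -
      (Matrix.of fun k l => ∑ p : Fin (h + h + 1) × Fin (h + h + 1), X p (k, l) *
        (Matrix.single a b (1 : ℂ) - Matrix.single b a (1 : ℂ)) p.1 p.2)ᵀ) with hM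
  have hMT : Mᵀ = -M := transpose_half_sub_transpose _
  have hskew : ∀ k l, M l k = -M k l := fun k l => by
    rw [← Matrix.transpose_apply M k l, hMT, Matrix.neg_apply]
  have hrow : ∀ r, r ≠ a → r ≠ b → ∀ j, M r j = 0 := fun r hra hrb j =>
    skewPart_linAct_wedge_apply_eq_zero hX hΦ hab hra hrb j
  have hd : ∀ i, M i i = 0 := fun i => by
    have e := hskew i i
    linear_combination e / 2
  ext k l
  simp only [Matrix.smul_apply, Matrix.sub_apply, smul_eq_mul, Matrix.single_apply]
  by_cases hka : k = a
  · by_cases hlb : l = b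
    · simp [hka, hlb, hab, hab.symm]
    · by_cases hla : l = a
      · simp [hka, hla, hd a, hab.symm]
      · have e : M a l = 0 := by rw [hskew l a, hrow l hla hlb a, neg_zero]
        simp [hka, e, Ne.symm hlb, hab.symm]
  · by_cases hkb : k = b
    · by_cases hla : l = a
      · have e : M b a = -M a b := hskew a b
        simp [hkb, hla, e, hab, hab.symm]
      · by_cases hlb : l = b
        · simp [hkb, hlb, hd b, hab]
        · have e : M b l = 0 := by rw [hskew l b, hrow l hla hlb b, neg_zero]
          simp [hkb, e, hab, Ne.symm hla, Ne.symm hlb]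
    · simp [hrow k hka hkb l, Ne.symm hka, Ne.symm hkb]

/-- `a′` is symmetric: `α(W_{ba})_{ba} = α(W_{ab})_{ab}` (both `α(W)` and `W` change sign).
[cite: LandsbergManivelRessayre2013, §3.5 (p. 481)] -/
theorem skewPart_linAct_wedge_apply_symm
    (X : Matrix (Fin (h + h + 1) × Fin (h + h + 1)) (Fin (h + h + 1) × Fin (h + h + 1)) ℂ)
    (a b : Fin (h + h + 1)) :
    ((1 / 2 : ℂ) • ((Matrix.of fun k l => ∑ p : Fin (h + h + 1) × Fin (h + h + 1), X p (k, l) *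
        (Matrix.single b a (1 : ℂ) - Matrix.single a b (1 : ℂ)) p.1 p.2) -
      (Matrix.of fun k l => ∑ p : Fin (h + h + 1) × Fin (h + h + 1), X p (k, l) *
        (Matrix.single b a (1 : ℂ) - Matrix.single a b (1 : ℂ)) p.1 p.2)ᵀ)) b a =
    ((1 / 2 : ℂ) • ((Matrix.of fun k l => ∑ p : Fin (h + h + 1) × Fin (h + h + 1), X p (k, l) *
        (Matrix.single a b (1 : ℂ) - Matrix.single b a (1 : ℂ)) p.1 p.2) -
      (Matrix.of fun k l => ∑ p : Fin (h + h + 1) × Fin (h + h + 1), X p (k, l) *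
        (Matrix.single a b (1 : ℂ) - Matrix.single b a (1 : ℂ)) p.1 p.2)ᵀ)) a b := by
  have hneg : (Matrix.single b a (1 : ℂ) - Matrix.single a b (1 : ℂ)) =
      (0 : Matrix (Fin (h + h + 1)) (Fin (h + h + 1)) ℂ) - (1 : ℂ) •
        (Matrix.single a b (1 : ℂ) - Matrix.single b a (1 : ℂ)) := by
    rw [one_smul, zero_sub, neg_sub]
  rw [hneg, skewPart_linAct_sub_smul, one_smul]
  have h0 : (1 / 2 : ℂ) • ((Matrix.of fun k l => ∑ p : Fin (h + h + 1) × Fin (h + h + 1), X p (k, l) *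
        (0 : Matrix (Fin (h + h + 1)) (Fin (h + h + 1)) ℂ) p.1 p.2) -
      (Matrix.of fun k l => ∑ p : Fin (h + h + 1) × Fin (h + h + 1), X p (k, l) *
        (0 : Matrix (Fin (h + h + 1)) (Fin (h + h + 1)) ℂ) p.1 p.2)ᵀ) = 0 := by
    ext k l
    simp
  rw [h0, zero_sub, Matrix.neg_apply, Matrix.smul_apply, Matrix.sub_apply, Matrix.transpose_apply,
    Matrix.smul_apply, Matrix.sub_apply, Matrix.transpose_apply, smul_eq_mul, smul_eq_mul]
  ring

/-! ### Exchange relations from the κ-identity -/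

/-- A sum over `Fin (h+h)` of a function vanishing off four distinct points.
[cite: LandsbergManivelRessayre2013, §3.5 (p. 481)] -/
theorem sum_eq_four {β : Type*} [AddCommMonoid β] {a b c d : Fin (h + h)} (hab : a ≠ b) (hac : a ≠ c)
    (had : a ≠ d) (hbc : b ≠ c) (hbd : b ≠ d) (hcd : c ≠ d) (F : Fin (h + h) → β)
    (hF : ∀ x, x ≠ a → x ≠ b → x ≠ c → x ≠ d → F x = 0) :
    ∑ x, F x = F a + F b + F c + F d := by
  classical
  have hsub : ({a, b, c, d} : Finset (Fin (h + h))) ⊆ Finset.univ := Finset.subset_univ _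
  rw [← Finset.sum_subset hsub (fun x _ hx => hF x (fun e => hx (by simp [e])) (fun e => hx (by simp [e]))
    (fun e => hx (by simp [e])) (fun e => hx (by simp [e])))]
  rw [Finset.sum_insert (by simp [hab, hac, had]), Finset.sum_insert (by simp [hbc, hbd]),
    Finset.sum_insert (by simp [hcd]), Finset.sum_singleton]
  abel

/-- **Exchange relations** (memo §5, `n ≥ 5`): if the sums `Σ_x a′_{r↑x, r↑(πx)}` are the same for all
fixed-point-free involutions `π` of the indices `≠ r` (the κ-identity of the sibling file), then for pairwise
distinct `a, b, c, d` off `r`: `a′_{ab} + a′_{cd} = a′_{ac} + a′_{bd}`, for any symmetric coefficient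
function `a′`. [cite: LandsbergManivelRessayre2013, §3.5 (p. 481)] -/
theorem exchange_of_sum_invariant (a' : Fin (h + h + 1) → Fin (h + h + 1) → ℂ)
    (hsymm : ∀ i j, a' i j = a' j i) (r : Fin (h + h + 1))
    (hκ : ∀ π ρ : Equiv.Perm (Fin (h + h)), (∀ x, π (π x) = x) → (∀ x, π x ≠ x) →
      (∀ x, ρ (ρ x) = x) → (∀ x, ρ x ≠ x) →
      ∑ x, a' (r.succAbove x) (r.succAbove (π x)) = ∑ x, a' (r.succAbove x) (r.succAbove (ρ x)))
    {a b c d : Fin (h + h)} (hab : a ≠ b) (hac : a ≠ c) (had : a ≠ d) (hbc : b ≠ c) (hbd : b ≠ d)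
    (hcd : c ≠ d) :
    a' (r.succAbove a) (r.succAbove b) + a' (r.succAbove c) (r.succAbove d) =
      a' (r.succAbove a) (r.succAbove c) + a' (r.succAbove b) (r.succAbove d) := by
  obtain ⟨π, hπ, hfix, hπa, hπc⟩ := exists_involution_apply_eq_apply_eq hab hcd hac.symm hbc.symm had.symm hbd.symm
  obtain ⟨hρ, hρfix, hρa, hρb, hρoff⟩ := exchange_involution hπ hfix hπa hπc hac hbd
  set ρ := Equiv.swap b c * π * Equiv.swap b c with hρ_def
  have key := hκ π ρ hπ hfix hρ hρfix
  rw [← sub_eq_zero, ← Finset.sum_sub_distrib] at key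
  have hπb : π b = a := by rw [← hπa, hπ]
  have hπd : π d = c := by rw [← hπc, hπ]
  have hρc : ρ c = a := by rw [← hρa, hρ]
  have hρd : ρ d = b := by rw [← hρb, hρ]
  rw [sum_eq_four hab hac had hbc hbd hcd _ (fun x hxa hxb hxc hxd => by
    rw [hρoff x hxa hxb hxc hxd, sub_self]), hπa, hπb, hπc, hπd, hρa, hρb, hρc, hρd,
    hsymm (r.succAbove b) (r.succAbove a), hsymm (r.succAbove d) (r.succAbove c),
    hsymm (r.succAbove c) (r.succAbove a), hsymm (r.succAbove d) (r.succAbove b)] at key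
  linear_combination key / 2

/-- Four distinct indices of `Fin (h+h+1)` (`h ≥ 2`) miss a fifth one. [cite: LandsbergManivelRessayre2013, §3.5 (p. 481)] -/
theorem exists_ne_four (hh : 2 ≤ h) (i j k l : Fin (h + h + 1)) :
    ∃ r : Fin (h + h + 1), r ≠ i ∧ r ≠ j ∧ r ≠ k ∧ r ≠ l := by
  classical
  have h4 : ({i, j, k, l} : Finset (Fin (h + h + 1))).card ≤ 4 := by
    refine (Finset.card_insert_le _ _).trans ?_
    refine (Nat.succ_le_succ (Finset.card_insert_le _ _)).trans ?_
    refine (Nat.succ_le_succ (Nat.succ_le_succ (Finset.card_insert_le _ _))).trans ?_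
    rw [Finset.card_singleton]
  have hlt : ({i, j, k, l} : Finset (Fin (h + h + 1))).card < (Finset.univ : Finset (Fin (h + h + 1))).card := by
    rw [Finset.card_univ, Fintype.card_fin]
    omega
  obtain ⟨r, -, hr⟩ := Finset.exists_mem_notMem_of_card_lt_card hlt
  refine ⟨r, ?_, ?_, ?_, ?_⟩ <;> rintro rfl <;> simp at hr

/-- **Exchange relations in absolute indices**: under the π-independence hypothesis at every base point `r`,
for pairwise distinct `i, j, k, l` in `Fin (h+h+1)` (`h ≥ 2`): `a′_{ij} + a′_{kl} = a′_{ik} + a′_{jl}`.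
[cite: LandsbergManivelRessayre2013, §3.5 (p. 481)] -/
theorem exchange_abs_of_sum_invariant (hh : 2 ≤ h) (a' : Fin (h + h + 1) → Fin (h + h + 1) → ℂ)
    (hsymm : ∀ i j, a' i j = a' j i)
    (hκ : ∀ (r : Fin (h + h + 1)) (π ρ : Equiv.Perm (Fin (h + h))), (∀ x, π (π x) = x) → (∀ x, π x ≠ x) →
      (∀ x, ρ (ρ x) = x) → (∀ x, ρ x ≠ x) →
      ∑ x, a' (r.succAbove x) (r.succAbove (π x)) = ∑ x, a' (r.succAbove x) (r.succAbove (ρ x)))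
    {i j k l : Fin (h + h + 1)} (hij : i ≠ j) (hik : i ≠ k) (hil : i ≠ l) (hjk : j ≠ k) (hjl : j ≠ l)
    (hkl : k ≠ l) :
    a' i j + a' k l = a' i k + a' j l := by
  obtain ⟨r, hri, hrj, hrk, hrl⟩ := exists_ne_four hh i j k l
  obtain ⟨a, rfl⟩ := Fin.exists_succAbove_eq hri.symm
  obtain ⟨b, rfl⟩ := Fin.exists_succAbove_eq hrj.symm
  obtain ⟨c, rfl⟩ := Fin.exists_succAbove_eq hrk.symm
  obtain ⟨d, rfl⟩ := Fin.exists_succAbove_eq hrl.symm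
  have hne : ∀ {x y : Fin (h + h)}, r.succAbove x ≠ r.succAbove y → x ≠ y := fun hxy e => hxy (by rw [e])
  exact exchange_of_sum_invariant a' hsymm r (hκ r) (hne hij) (hne hik) (hne hil) (hne hjk) (hne hjl) (hne hkl)

/-! ### Block (III-b): all `a′` vanish, hence `α = 0` on skew matrices -/

/-- A skew matrix is half the sum of its entries times the elementary skew matrices:
`2·A = Σ_{a,b} A_{ab} · (E_{ab} − E_{ba})`. [cite: LandsbergManivelRessayre2013, §3.5 (p. 481)] -/
theorem two_smul_eq_sum_smul_wedge {n : ℕ} {A : Matrix (Fin n) (Fin n) ℂ} (hA : Aᵀ = -A) :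
    (2 : ℂ) • A = ∑ a, ∑ b, A a b • (Matrix.single a b (1 : ℂ) - Matrix.single b a (1 : ℂ)) := by
  have h1 : ∑ a, ∑ b, A a b • Matrix.single a b (1 : ℂ) = A := by
    conv_rhs => rw [Matrix.matrix_eq_sum_single A]
    refine Finset.sum_congr rfl fun a _ => Finset.sum_congr rfl fun b _ => ?_
    rw [Matrix.smul_single, smul_eq_mul, mul_one]
  have h2 : ∑ a, ∑ b, A a b • Matrix.single b a (1 : ℂ) = Aᵀ := by
    conv_rhs => rw [Matrix.matrix_eq_sum_single Aᵀ, Finset.sum_comm]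
    refine Finset.sum_congr rfl fun a _ => Finset.sum_congr rfl fun b _ => ?_
    rw [Matrix.smul_single, smul_eq_mul, mul_one, Matrix.transpose_apply]
  simp only [smul_sub, Finset.sum_sub_distrib, h1, h2, hA, sub_neg_eq_add, two_smul]

/-- **Block (III-b) modulo the κ-identity.** For `X ∈ 𝔤𝔩(W)_{P_Λ}` (`n = h+h+1`, `h ≥ 2`): if the
functionals `Φ_{ra} = (L_X S_{ra})_{rr}` (`r ≠ a`), `Ψ_j = 2a′_{0j}` (`j ≠ 0`) and `Ψ_{12} = 2a′_{12}` vanish,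
and the pair sums `Σ_x a′_{r↑x, r↑(πx)}` do not depend on the fixed-point-free involution `π` (κ-identity,
sibling file), then the `Λ² → Λ²` block of `X` vanishes: `½(L_X A − (L_X A)ᵀ) = 0` for every skew `A`
(binder shape of the `blockIII` hypothesis of `finrank_glAnn_pLambda_le_of_blocks`, plus `hκ`). Route:
`α(W_{ab}) = a′_{ab} W_{ab}` (III-a), exchange relations, `a′_{0j} = a′_{12} = 0` ⇒ all `a′ = 0`, linearity.
[cite: LandsbergManivelRessayre2013, §3.5 (p. 481)] -/
theorem skewPart_linAct_skew_eq_zero_of_kappa (hh : 2 ≤ h)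
    {X : Matrix (Fin (h + h + 1) × Fin (h + h + 1)) (Fin (h + h + 1) × Fin (h + h + 1)) ℂ}
    (hX : X ∈ glAnn (pLambda (h + h + 1)))
    (hΦ : ∀ r a : Fin (h + h + 1), r ≠ a →
      (Matrix.of fun k l => ∑ p : Fin (h + h + 1) × Fin (h + h + 1), X p (k, l) *
        (Matrix.single r a (1 : ℂ) + Matrix.single a r (1 : ℂ)) p.1 p.2) r r = 0)
    (hΨ : ∀ j : Fin (h + h + 1), j ≠ 0 →
      (Matrix.of fun k l => ∑ p : Fin (h + h + 1) × Fin (h + h + 1), X p (k, l) *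
          (Matrix.single (0 : Fin (h + h + 1)) j (1 : ℂ) - Matrix.single j (0 : Fin (h + h + 1)) (1 : ℂ)) p.1 p.2)
          0 j -
        (Matrix.of fun k l => ∑ p : Fin (h + h + 1) × Fin (h + h + 1), X p (k, l) *
          (Matrix.single (0 : Fin (h + h + 1)) j (1 : ℂ) - Matrix.single j (0 : Fin (h + h + 1)) (1 : ℂ)) p.1 p.2)
          j 0 = 0)
    (hΨ12 : (Matrix.of fun k l => ∑ p : Fin (h + h + 1) × Fin (h + h + 1), X p (k, l) *
          (Matrix.single (⟨1, by omega⟩ : Fin (h + h + 1)) (⟨2, by omega⟩ : Fin (h + h + 1)) (1 : ℂ) -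
            Matrix.single (⟨2, by omega⟩ : Fin (h + h + 1)) (⟨1, by omega⟩ : Fin (h + h + 1)) (1 : ℂ)) p.1 p.2)
          (⟨1, by omega⟩ : Fin (h + h + 1)) (⟨2, by omega⟩ : Fin (h + h + 1)) -
        (Matrix.of fun k l => ∑ p : Fin (h + h + 1) × Fin (h + h + 1), X p (k, l) *
          (Matrix.single (⟨1, by omega⟩ : Fin (h + h + 1)) (⟨2, by omega⟩ : Fin (h + h + 1)) (1 : ℂ) -
            Matrix.single (⟨2, by omega⟩ : Fin (h + h + 1)) (⟨1, by omega⟩ : Fin (h + h + 1)) (1 : ℂ)) p.1 p.2)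
          (⟨2, by omega⟩ : Fin (h + h + 1)) (⟨1, by omega⟩ : Fin (h + h + 1)) = 0)
    (hκ : ∀ (r : Fin (h + h + 1)) (π ρ : Equiv.Perm (Fin (h + h))), (∀ x, π (π x) = x) → (∀ x, π x ≠ x) →
      (∀ x, ρ (ρ x) = x) → (∀ x, ρ x ≠ x) →
      ∑ x, ((1 / 2 : ℂ) • ((Matrix.of fun k l => ∑ p : Fin (h + h + 1) × Fin (h + h + 1), X p (k, l) *
            (Matrix.single (r.succAbove x) (r.succAbove (π x)) (1 : ℂ) -
              Matrix.single (r.succAbove (π x)) (r.succAbove x) (1 : ℂ)) p.1 p.2) -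
          (Matrix.of fun k l => ∑ p : Fin (h + h + 1) × Fin (h + h + 1), X p (k, l) *
            (Matrix.single (r.succAbove x) (r.succAbove (π x)) (1 : ℂ) -
              Matrix.single (r.succAbove (π x)) (r.succAbove x) (1 : ℂ)) p.1 p.2)ᵀ))
          (r.succAbove x) (r.succAbove (π x)) =
      ∑ x, ((1 / 2 : ℂ) • ((Matrix.of fun k l => ∑ p : Fin (h + h + 1) × Fin (h + h + 1), X p (k, l) *
            (Matrix.single (r.succAbove x) (r.succAbove (ρ x)) (1 : ℂ) -
              Matrix.single (r.succAbove (ρ x)) (r.succAbove x) (1 : ℂ)) p.1 p.2) -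
          (Matrix.of fun k l => ∑ p : Fin (h + h + 1) × Fin (h + h + 1), X p (k, l) *
            (Matrix.single (r.succAbove x) (r.succAbove (ρ x)) (1 : ℂ) -
              Matrix.single (r.succAbove (ρ x)) (r.succAbove x) (1 : ℂ)) p.1 p.2)ᵀ))
          (r.succAbove x) (r.succAbove (ρ x)))
    (A : Matrix (Fin (h + h + 1)) (Fin (h + h + 1)) ℂ) (hA : Aᵀ = -A) :
    (1 / 2 : ℂ) • ((Matrix.of fun k l => ∑ p : Fin (h + h + 1) × Fin (h + h + 1), X p (k, l) * A p.1 p.2) -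
      (Matrix.of fun k l => ∑ p : Fin (h + h + 1) × Fin (h + h + 1), X p (k, l) * A p.1 p.2)ᵀ) = 0 := by
  -- the diagonal form and the symmetry of `a′`, before folding
  have hdiag : ∀ {a b : Fin (h + h + 1)}, a ≠ b → _ := fun {a b} hab => skewPart_linAct_wedge_eq_smul hX hΦ hab
  have hsym0 := skewPart_linAct_wedge_apply_symm X
  -- fold `α(M) = ½(L_X M − (L_X M)ᵀ)` and `W_{ab}`
  obtain ⟨α, hα⟩ : ∃ α : Matrix (Fin (h + h + 1)) (Fin (h + h + 1)) ℂ → Matrix (Fin (h + h + 1)) (Fin (h + h + 1)) ℂ,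
      α = fun M => (1 / 2 : ℂ) • ((Matrix.of fun k l => ∑ p : Fin (h + h + 1) × Fin (h + h + 1),
        X p (k, l) * M p.1 p.2) - (Matrix.of fun k l => ∑ p : Fin (h + h + 1) × Fin (h + h + 1),
        X p (k, l) * M p.1 p.2)ᵀ) := ⟨_, rfl⟩
  have hα' : ∀ M : Matrix (Fin (h + h + 1)) (Fin (h + h + 1)) ℂ,
      (1 / 2 : ℂ) • ((Matrix.of fun k l => ∑ p : Fin (h + h + 1) × Fin (h + h + 1), X p (k, l) * M p.1 p.2) -
        (Matrix.of fun k l => ∑ p : Fin (h + h + 1) × Fin (h + h + 1), X p (k, l) * M p.1 p.2)ᵀ) = α M :=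
    fun M => by rw [hα]
  obtain ⟨W, hW⟩ : ∃ W : Fin (h + h + 1) → Fin (h + h + 1) → Matrix (Fin (h + h + 1)) (Fin (h + h + 1)) ℂ,
      W = fun a b => Matrix.single a b (1 : ℂ) - Matrix.single b a (1 : ℂ) := ⟨_, rfl⟩
  have hW' : ∀ a b : Fin (h + h + 1), Matrix.single a b (1 : ℂ) - Matrix.single b a (1 : ℂ) = W a b :=
    fun a b => by rw [hW]
  simp only [hα', hW'] at hdiag hsym0 hΨ12 hκ ⊢
  -- `Ψ_j` in folded form
  have hΨ' : ∀ j : Fin (h + h + 1), j ≠ 0 → α (W 0 j) 0 j = 0 := by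
    intro j hj
    have e := hΨ j hj
    have e2 : α (W 0 j) 0 j = (1 / 2 : ℂ) * ((Matrix.of fun k l => ∑ p : Fin (h + h + 1) × Fin (h + h + 1),
        X p (k, l) * (Matrix.single (0 : Fin (h + h + 1)) j (1 : ℂ) -
          Matrix.single j (0 : Fin (h + h + 1)) (1 : ℂ)) p.1 p.2) 0 j -
        (Matrix.of fun k l => ∑ p : Fin (h + h + 1) × Fin (h + h + 1),
        X p (k, l) * (Matrix.single (0 : Fin (h + h + 1)) j (1 : ℂ) -
          Matrix.single j (0 : Fin (h + h + 1)) (1 : ℂ)) p.1 p.2) j 0) := by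
      rw [hα, hW]
      simp only [Matrix.smul_apply, Matrix.sub_apply, Matrix.transpose_apply, smul_eq_mul]
    rw [e2, e, mul_zero]
  have hΨ12' : α (W ⟨1, by omega⟩ ⟨2, by omega⟩) ⟨1, by omega⟩ ⟨2, by omega⟩ = 0 := by
    rw [hα]
    simp only [Matrix.smul_apply, Matrix.sub_apply, Matrix.transpose_apply, smul_eq_mul]
    rw [hΨ12, mul_zero]
  -- linearity of `α`
  have hαsub : ∀ M M' (c : ℂ), α (M - c • M') = α M - c • α M' := fun M M' c => by
    have e := skewPart_linAct_sub_smul X M M' c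
    simpa only [hα'] using e
  have hα0 : α 0 = 0 := by
    have e := hαsub 0 0 1
    rwa [one_smul, sub_self, one_smul, sub_self] at e
  have hαsmul : ∀ (c : ℂ) M, α (c • M) = c • α M := fun c M => by
    have e := hαsub 0 M (-c)
    rwa [neg_smul, sub_neg_eq_add, zero_add, hα0, neg_smul, sub_neg_eq_add, zero_add] at e
  have hαadd : ∀ M M', α (M + M') = α M + α M' := fun M M' => by
    have e := hαsub M M' (-1)
    rwa [neg_one_smul, sub_neg_eq_add, neg_one_smul, sub_neg_eq_add] at e
  have hαsum : ∀ (F : Fin (h + h + 1) → Matrix (Fin (h + h + 1)) (Fin (h + h + 1)) ℂ),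
      α (∑ i, F i) = ∑ i, α (F i) := by
    intro F
    classical
    induction (Finset.univ : Finset (Fin (h + h + 1))) using Finset.induction_on with
    | empty => rw [Finset.sum_empty, Finset.sum_empty, hα0]
    | insert i s hi ih => rw [Finset.sum_insert hi, Finset.sum_insert hi, hαadd, ih]
  -- the coefficient function and its properties
  set a' : Fin (h + h + 1) → Fin (h + h + 1) → ℂ := fun i j => α (W i j) i j with ha'
  have hsymm : ∀ i j, a' i j = a' j i := fun i j => by
    show α (W i j) i j = α (W j i) j i
    exact hsym0 j i
  have hexch : ∀ {i j k l : Fin (h + h + 1)}, i ≠ j → i ≠ k → i ≠ l → j ≠ k → j ≠ l → k ≠ l →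
      a' i j + a' k l = a' i k + a' j l :=
    fun {i j k l} => exchange_abs_of_sum_invariant hh a' hsymm hκ
  -- all `a′` vanish
  set i0 : Fin (h + h + 1) := 0 with hi0
  set i1 : Fin (h + h + 1) := ⟨1, by omega⟩ with hi1
  set i2 : Fin (h + h + 1) := ⟨2, by omega⟩ with hi2
  have h01 : i0 ≠ i1 := by rw [hi0, hi1]; exact fun e => absurd (congrArg Fin.val e) (by simp)
  have h02 : i0 ≠ i2 := by rw [hi0, hi2]; exact fun e => absurd (congrArg Fin.val e) (by simp)
  have h12 : i1 ≠ i2 := by rw [hi1, hi2]; exact fun e => absurd (congrArg Fin.val e) (by simp)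
  have z0 : ∀ j, j ≠ i0 → a' i0 j = 0 := fun j hj => hΨ' j hj
  have z0' : ∀ j, j ≠ i0 → a' j i0 = 0 := fun j hj => by rw [hsymm]; exact z0 j hj
  have z12 : a' i1 i2 = 0 := hΨ12'
  -- step 1: `a′_{l2} = 0` for `l ∉ {0,1,2}`
  have step1 : ∀ l, l ≠ i0 → l ≠ i1 → l ≠ i2 → a' l i2 = 0 := by
    intro l hl0 hl1 hl2
    have e := hexch h01 (Ne.symm hl0) h02 (Ne.symm hl1) h12 hl2
    -- a' 0 1 + a' l 2 = a' 0 l + a' 1 2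
    rw [z0 i1 h01.symm, z0 l hl0, z12] at e
    linear_combination e
  -- step 2: `a′_{1l} = 0` for `l ∉ {0,1,2}`
  have step2 : ∀ l, l ≠ i0 → l ≠ i1 → l ≠ i2 → a' i1 l = 0 := by
    intro l hl0 hl1 hl2
    have e := hexch h02 h01 (Ne.symm hl0) h12.symm (Ne.symm hl2) (Ne.symm hl1)
    -- a' 0 2 + a' 1 l = a' 0 1 + a' 2 l
    rw [z0 i2 h02.symm, z0 i1 h01.symm, hsymm i2 l, step1 l hl0 hl1 hl2] at e
    linear_combination e
  have hzero : ∀ k l, k ≠ l → a' k l = 0 := by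
    intro k l hkl
    by_cases hk0 : k = i0
    · subst hk0; exact z0 l (Ne.symm hkl)
    by_cases hl0 : l = i0
    · subst hl0; exact z0' k hk0
    by_cases hk1 : k = i1
    · subst hk1
      by_cases hl2 : l = i2
      · subst hl2; exact z12
      · exact step2 l hl0 (Ne.symm hkl) hl2
    by_cases hl1 : l = i1
    · subst hl1
      rw [hsymm]
      by_cases hk2 : k = i2
      · subst hk2; exact z12
      · exact step2 k hk0 hkl hk2
    by_cases hk2 : k = i2
    · subst hk2
      rw [hsymm]
      exact step1 l hl0 hl1 (Ne.symm hkl)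
    by_cases hl2 : l = i2
    · subst hl2
      exact step1 k hk0 hk1 hkl
    -- k, l ∉ {0,1,2}: exchange (0,1,k,l)
    have e := hexch h01 (Ne.symm hk0) (Ne.symm hl0) (Ne.symm hk1) (Ne.symm hl1) hkl
    rw [z0 i1 h01.symm, z0 k hk0, step2 l hl0 hl1 hl2] at e
    linear_combination e
  -- `α(W_{kl}) = 0`
  have hαW : ∀ k l, α (W k l) = 0 := by
    intro k l
    by_cases hkl : k = l
    · subst hkl
      have hW0 : W k k = 0 := by rw [hW]; exact sub_self _
      rw [hW0, hα0]
    · rw [hdiag hkl]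
      show a' k l • W k l = 0
      rw [hzero k l hkl, zero_smul]
  -- assemble
  have h2 : (2 : ℂ) • α A = 0 := by
    have e := two_smul_eq_sum_smul_wedge hA
    simp only [hW'] at e
    rw [← hαsmul, e, hαsum]
    refine Finset.sum_eq_zero fun a _ => ?_
    rw [hαsum]
    refine Finset.sum_eq_zero fun b _ => ?_
    rw [hαsmul, hαW a b, smul_zero]
  rcases smul_eq_zero.mp h2 with h0 | h0
  · norm_num at h0
  · exact h0

end SkewAdj

end Literature.Computability.AlgebraicComplexity

end
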